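import Summits.FinalStateConjecture.FinalStateConjecture.Theorems.KerrnessPropagatesKillingSpinorEndgameInteriorIdle
import Summits.FinalStateConjecture.FinalStateConjecture.Theorems.KerrBasinCapture.Negative.NonOrthochronousHandover
import Literature.Geometry.Lorentzian.BoostedKerrSchildDecay

/-!
# The white-hole sector of `KillingSpinorEndgame`: one exact boosted Kerr–Schild slab of ANY Lorentz
# orientation already triggers the crux (crux stmt-FinalStateConjecture-17645, route `KerrnessPropagates`;
# a finding about the TYPING of clause (i), kernel-checked form of F1 + F2 of the lead dossiers)

Clause (i) of `Theses.KerrnessPropagates.KillingSpinorEndgame` asks, for a FIXED configuration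
`p = (N; Mᵢ, aᵢ, r₀ᵢ; Λᵢ, cᵢ)` with `Λᵢ` in the prelude's `lorentzGroup` — the FULL group `O(1,3)`
(`TameCensorship.Negative.timeReversal_mem_lorentzGroup`) — and for every accuracy `ε > 0`, "beyond every
lab time" ONE `ε`-good achronal slab chart (`SlabClauses`, p152635). Two facts about this typing are
already kernel-checked: the lateness quantifier is idle for `N ≤ 1` (`recurrence_one_iff`, p152635) and
the motions need not be orthochronous (`KerrBasinCapture.Negative.exists_handover_motion_not_isOrthochronous`,
p146528). This file composes them with the far-field decay of the boosted Kerr–Schild perturbation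
(`norm_iteratedFDeriv_boostedKsPert_le`, `BoostedKerrSchildDecay.lean`) into the statement the planner
needs in order to restate the crux:

* `slabClauses_of_exact` — ONE chart `Φ : U → 𝒟` on a neighbourhood `U` of the punctured hyperplane
  `{x⁰ = τ, r > r₀}` which pulls `g` back to the boosted Kerr–Schild form `boostedKerrBilin Λ c M a`
  EXACTLY (achronal leaf, `range Φ ⊆ J⁺(ιX)`, `Φ_*∂₀` future-directed beyond some radius) satisfies the
  nine slab clauses at EVERY accuracy `ε > 0` and EVERY regularity `k` (near-zone deviation `≡ 0`;
  far-zone deviation `= boostedKerrBilin − η`, whose derivatives of order `≤ k` are `≤ C/r`; choose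
  `R ≥ 1 + max(R_dec, ρ, C/ε)`), hence (`recurs_of_exact`) clause (i) of the crux for the one-hole
  configuration `(M, a, r₀, (Λ, c))` — for ANY `Λ ∈ O(1,3)`;
* `honestExterior_of_exactSlab` — consequently the crux AS FILED contains: every admissible MGHD with
  complete `𝓘⁺` carrying one such exact slab with sub-extremal `(M, a)` and `r₀ ∈ (r₋, r₊)` admits an
  honest exterior decomposition (sub-extremal holes, `O = exteriorOf`, `HasExhaustiveCharts`,
  `IsFutureOriented`; hypothesis (ii) is idle, `killingSpinorEndgame_iff_honest`, p158979);
* `whiteHole_settles_of_killingSpinorEndgame` — the case `Λ = T` (time reversal, NOT orthochronous,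
  `KerrBasinCapture.Negative.not_isOrthochronous_timeReversalLorentz`), `a = 0`, `r₀ ∈ (0, 2M)`: the
  reference form `boostedKerrBilin T c M 0` is the time-reversed = OUTGOING Eddington–Finkelstein /
  Kerr–Schild Schwarzschild form, written out EXPLICITLY
  (`kerr_bilin_timeReversal_eq_outgoing`: `η(v, w) + (2M/r)(v⁰ − z̲·v̲/r)(w⁰ − z̲·w̲/r)`, `z = x − c`,
  `r = ‖z̲‖`), regular across the PAST horizon `r = 2M`, so the hypothesis is ONE exact
  white-hole-straddling Schwarzschild slab `{x⁰ = τ, r > r₀}`, `r₀ < 2M`, anywhere in `J⁺(ιX)` — an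
  `ε`-free, lateness-free, smallness-free premise about an EARLY region — and the conclusion is the
  full settled clause of the Statement for that development. On this sector the
  crux is therefore the POINTWISE large-data final-state assertion for white-hole-emergent data (the
  ℝP³-geon configuration of `Cruxes/KillingSpinorEndgame/Lines/registered_dead.md` §2 satisfies the
  premise), which no perturbative engine (Killing-spinor coercivity, hidden-symmetry decay about ONE
  Kerr) addresses; the one-clause repair is `IsOrthochronous (mo i).1` in clause (i) (F2).

Pure logic and calculus over the route file and the prelude; the crux is not claimed false.
References: Theses/KerrnessPropagates.lean (stmt-17645); Kerr–Schild 1965, §2–§3 (Lorentz covariance and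
asymptotic flatness of the ansatz); O'Neill 1983, Ch. 9, pp. 233–236 (`O(1,3)` and its components);
DHRT arXiv:2104.08222, §1 (the `Cᵏ`-deviation vocabulary).
-/

open Literature.Geometry.Lorentzian
open scoped Manifold ContDiff Topology ENNReal
open Filter Set TopologicalSpace Function

-- `FinalStateConjecture.FinalStateConjecture` repeats summit = sub-problem (D-0017); deliberate.
set_option linter.dupNamespace false

noncomputable section

namespace Summit.FinalStateConjecture.FinalStateConjecture.Theorems.KerrnessPropagates

open Summit.FinalStateConjecture.FinalStateConjecture.Theses.KerrnessPropagates
open Summit.FinalStateConjecture.FinalStateConjecture.Theorems.TameCensorship.Negative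
open Summit.FinalStateConjecture.FinalStateConjecture.Theorems.KerrBasinCapture.Negative

/-! ### Two calculus helpers -/

/-- A `Cᵏ` sup norm is at most `ε` as soon as every derivative of order `≤ k` is pointwise `≤ ε` on the
set (Bartnik 1986, (1.3): the norm is a supremum of pointwise norms). [cite: Bartnik1986, (1.3)] -/
theorem supCkENorm_le_ofReal_of_forall_le {G : Type*} [NormedAddCommGroup G] [NormedSpace ℝ G]
    {S : Set E4} {k : ℕ} {f : E4 → G} {ε : ℝ}
    (h : ∀ m ≤ k, ∀ x ∈ S, ‖iteratedFDeriv ℝ m f x‖ ≤ ε) :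
    supCkENorm S k f ≤ ENNReal.ofReal ε := by
  unfold supCkENorm
  refine iSup₂_le fun m hm ↦ iSup₂_le fun x hx ↦ ?_
  rw [← ofReal_norm]
  exact ENNReal.ofReal_le_ofReal (h m hm x hx)

/-- **Uniform far-field decay of the boosted Kerr–Schild perturbation up to order `k`**: one constant
`C ≥ 0` and one radius `R > 0` serve all orders `m ≤ k` in
`‖D^m (boostedKerrBilin Λ c M a − η)(x)‖ ≤ C / r`, `r = r_a(Λ⁻¹(x − c)) ≥ R` (finite maximum over
`norm_iteratedFDeriv_boostedKsPert_le`). Kerr–Schild 1965, §3 (asymptotic flatness of the ansatz).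
[cite: KerrSchild1965, §3] -/
theorem exists_uniform_boostedKsPert_decay (Λ : lorentzGroup) (c : E4) (M a : ℝ) (k : ℕ) :
    ∃ C R : ℝ, 0 ≤ C ∧ 0 < R ∧ ∀ m ≤ k, ∀ x : E4, R ≤ Kerr.radius a (poincareInv Λ c x) →
      ‖iteratedFDeriv ℝ m (fun y ↦ boostedKerrBilin Λ c M a y - Minkowski.bilin) x‖ ≤
        C / Kerr.radius a (poincareInv Λ c x) := by
  induction k with
  | zero =>
    obtain ⟨C, R, hR, h⟩ := norm_iteratedFDeriv_boostedKsPert_le Λ c M a 0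
    refine ⟨max C 0, R, le_max_right _ _, hR, fun m hm x hx ↦ ?_⟩
    obtain rfl : m = 0 := Nat.le_zero.mp hm
    exact (h x hx).trans
      (div_le_div_of_nonneg_right (le_max_left _ _) (hR.le.trans hx))
  | succ k ih =>
    obtain ⟨C, R, hC, hR, h⟩ := ih
    obtain ⟨C', R', hR', h'⟩ := norm_iteratedFDeriv_boostedKsPert_le Λ c M a (k + 1)
    refine ⟨max C C', max R R', hC.trans (le_max_left _ _), lt_max_of_lt_left hR,
      fun m hm x hx ↦ ?_⟩
    have hr0 : 0 ≤ Kerr.radius a (poincareInv Λ c x) := hR.le.trans ((le_max_left _ _).trans hx)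
    rcases Nat.lt_or_eq_of_le hm with hlt | rfl
    · exact (h m (Nat.lt_succ_iff.mp hlt) x ((le_max_left _ _).trans hx)).trans
        (div_le_div_of_nonneg_right (le_max_left _ _) hr0)
    · exact (h' x ((le_max_right _ _).trans hx)).trans
        (div_le_div_of_nonneg_right (le_max_right _ _) hr0)

variable {X : Type} [TopologicalSpace X] [ChartedSpace E3 X] [IsManifold (𝓡 3) ∞ X]
  [ConnectedSpace X] {D : InitialDataSet (𝓡 3) X}

/-! ### One exact boosted Kerr–Schild slab satisfies the slab clauses at every accuracy -/

/-- **An exact boosted Kerr–Schild slab chart is `ε`-good for every `ε`.** Let `Φ : U → 𝒟` be a smooth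
open embedding of a neighbourhood `U` of the punctured hyperplane `{x⁰ = τ, r₀ < r_a(Λ⁻¹(x − c))}`, with
`range Φ ⊆ J⁺(ιX)`, achronal leaf `Φ({x⁰ = τ})`, `Φ_*∂₀` future-directed at the points of the leaf beyond
some rest-frame radius `ρ`, and which pulls `g` back to `boostedKerrBilin Λ c M a` EXACTLY on `U` — for
ANY `Λ ∈ O(1,3)`, orthochronous or not. Then for every `ε > 0` and every regularity `k` some near-zone
radius `R` makes `(R, U, Φ)` satisfy the nine slab clauses of clause (i) at `(ε, τ)` for the one-hole
configuration `(M, a, r₀, (Λ, c))`: the near-zone deviation vanishes identically, and on the far zone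
`{r ≥ R − 1}` the deviation from `η` is `boostedKerrBilin Λ c M a − η`, all of whose derivatives of order
`≤ k` are `≤ C/(R − 1) ≤ ε` (`exists_uniform_boostedKsPert_decay`; Kerr–Schild 1965, §3).
[cite: KerrSchild1965, §3] -/
theorem slabClauses_of_exact (𝒟 : VacuumCauchyDevelopment D) (k : ℕ) (M a r₀ : ℝ)
    (Λ : lorentzGroup) (c : E4) {U : Opens E4} {Φ : U → 𝒟.carrier} {τ : ℝ}
    (hsm : ContMDiff 𝓘(ℝ, E4) (𝓡 4) ∞ Φ) (hemb : Topology.IsOpenEmbedding Φ)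
    (hU : {x : E4 | x 0 = τ ∧ r₀ < Kerr.radius a (poincareInv Λ c x)} ⊆ (U : Set E4))
    (hJ : range Φ ⊆ 𝒟.metric.causalFuture 𝒟.timeOrientation (range 𝒟.embed))
    (hachr : 𝒟.metric.IsAchronal 𝒟.timeOrientation (Φ '' {x : ↥U | (x : E4) 0 = τ}))
    (hexact : ∀ (x : ↥U) (v w : E4),
      𝒟.metric.val (Φ x) (mfderiv 𝓘(ℝ, E4) (𝓡 4) Φ x v) (mfderiv 𝓘(ℝ, E4) (𝓡 4) Φ x w) =
        boostedKerrBilin Λ c M a x v w)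
    (horient : ∃ ρ : ℝ, ∀ x : ↥U, (x : E4) 0 = τ → ρ ≤ Kerr.radius a (poincareInv Λ c x) →
      𝒟.timeOrientation.IsFutureDirected (mfderiv 𝓘(ℝ, E4) (𝓡 4) Φ x (E4.basisVector 0)))
    {ε : ℝ} (hε : 0 < ε) :
    ∃ R : Fin 1 → ℝ, SlabClauses 𝒟 k 1 (fun _ ↦ M) (fun _ ↦ a) (fun _ ↦ r₀) (fun _ ↦ (Λ, c)) ε τ
      R U Φ := by
  obtain ⟨C, Rd, hC, hRd, hdec⟩ := exists_uniform_boostedKsPert_decay Λ c M a k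
  obtain ⟨ρ, hρ⟩ := horient
  -- one radius beyond the tie, the decay radius, the orientation radius and `C/ε`
  set R₁ : ℝ := max (r₀ + 1) (max (Rd + 1) (max (ρ + 1) (C / ε + 1))) with hR₁
  have h_tie : r₀ + 1 ≤ R₁ := le_max_left _ _
  have h_dec : Rd ≤ R₁ - 1 := by
    have : Rd + 1 ≤ R₁ := (le_max_left _ _).trans (le_max_right _ _)
    linarith
  have h_or : ρ ≤ R₁ - 1 := by
    have : ρ + 1 ≤ R₁ := ((le_max_left _ _).trans (le_max_right _ _)).trans (le_max_right _ _)
    linarith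
  have h_eps : C / ε ≤ R₁ - 1 := by
    have : C / ε + 1 ≤ R₁ := ((le_max_right _ _).trans (le_max_right _ _)).trans (le_max_right _ _)
    linarith
  have hR1pos : 0 < R₁ - 1 := hRd.trans_le h_dec
  refine ⟨fun _ ↦ R₁, fun _ ↦ h_tie, hsm, hemb, ?_, hJ, hachr, ?_, ?_, ?_⟩
  · -- the punctured hyperplane of the one-hole configuration lies in `U`
    rintro x ⟨hx0, hxr⟩
    exact hU ⟨hx0, hxr 0⟩
  · -- near zone: the deviation from the boosted Kerr–Schild reference vanishes identically
    intro i
    set B : ModelBackground := ⟨U, boostedKerrBilin Λ c M a, fun x ↦ x 0,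
      fun x ↦ Kerr.radius a (poincareInv Λ c x)⟩ with hB
    have hzero : 𝒟.toSpacetime.deviationExtend B Φ = 0 := by
      funext y
      by_cases hy : y ∈ (U : Set E4)
      · rw [show y = ((⟨y, hy⟩ : ↥U) : E4) from rfl,
          Spacetime.deviationExtend_coe 𝒟.toSpacetime B Φ ⟨y, hy⟩]
        ext v w
        rw [Spacetime.deviation_apply]
        exact (congrArg (fun t : ℝ ↦ t - boostedKerrBilin Λ c M a y v w) (hexact ⟨y, hy⟩ v w)).trans
          (sub_self _)
      · exact Spacetime.deviationExtend_of_not_mem 𝒟.toSpacetime B Φ hy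
    change supCkENorm _ k (𝒟.toSpacetime.deviationExtend B Φ) ≤ ENNReal.ofReal ε
    rw [hzero, supCkENorm_zero]
    exact bot_le
  · -- far zone: the deviation from `η` is the boosted Kerr–Schild perturbation, which decays
    refine supCkENorm_le_ofReal_of_forall_le fun m hm x hx ↦ ?_
    obtain ⟨hx0, hxr, hxR⟩ := hx
    have hxU : x ∈ (U : Set E4) := hU ⟨hx0, hxr 0⟩
    have hloc : 𝒟.toSpacetime.deviationExtend (Minkowski.backgroundOn U) Φ =ᶠ[𝓝 x]
        fun y ↦ boostedKerrBilin Λ c M a y - Minkowski.bilin := by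
      filter_upwards [U.isOpen.mem_nhds hxU] with y hy
      rw [show y = ((⟨y, hy⟩ : ↥U) : E4) from rfl,
        Spacetime.deviationExtend_coe 𝒟.toSpacetime (Minkowski.backgroundOn U) Φ ⟨y, hy⟩]
      ext v w
      rw [Spacetime.deviation_apply]
      exact congrArg (fun t : ℝ ↦ t - Minkowski.bilin v w) (hexact ⟨y, hy⟩ v w)
    rw [(Filter.EventuallyEq.iteratedFDeriv ℝ hloc m).eq_of_nhds]
    have hrad : R₁ - 1 ≤ Kerr.radius a (poincareInv Λ c x) := hxR 0
    have hrpos : 0 < Kerr.radius a (poincareInv Λ c x) := hR1pos.trans_le hrad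
    calc ‖iteratedFDeriv ℝ m (fun y ↦ boostedKerrBilin Λ c M a y - Minkowski.bilin) x‖
        ≤ C / Kerr.radius a (poincareInv Λ c x) := hdec m hm x (h_dec.trans hrad)
      _ ≤ C / (R₁ - 1) := div_le_div_of_nonneg_left hC hR1pos hrad
      _ ≤ ε := by
          rw [div_le_iff₀ hR1pos]
          calc C = ε * (C / ε) := by field_simp
            _ ≤ ε * (R₁ - 1) := mul_le_mul_of_nonneg_left h_eps hε.le
  · -- orientation on the far zone: beyond `ρ`
    intro x hx0 hxR
    exact hρ x hx0 (h_or.trans (hxR 0))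

/-- **One exact slab gives clause (i) of the crux for the one-hole configuration `(M, a, r₀, (Λ, c))`, at
every regularity `k`** — for every `ε > 0` and beyond every lab time `τ₁` (the lateness quantifier is idle,
`recurrence_one_iff`; the accuracy quantifier is met by the one exact chart, `slabClauses_of_exact`).
Kerr–Schild 1965, §3; the label calculus of p152635. [cite: KerrSchild1965, §3] -/
theorem recurs_of_exact (𝒟 : VacuumCauchyDevelopment D) (k : ℕ) (M a r₀ : ℝ)
    (Λ : lorentzGroup) (c : E4) {U : Opens E4} {Φ : U → 𝒟.carrier} {τ : ℝ}
    (hsm : ContMDiff 𝓘(ℝ, E4) (𝓡 4) ∞ Φ) (hemb : Topology.IsOpenEmbedding Φ)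
    (hU : {x : E4 | x 0 = τ ∧ r₀ < Kerr.radius a (poincareInv Λ c x)} ⊆ (U : Set E4))
    (hJ : range Φ ⊆ 𝒟.metric.causalFuture 𝒟.timeOrientation (range 𝒟.embed))
    (hachr : 𝒟.metric.IsAchronal 𝒟.timeOrientation (Φ '' {x : ↥U | (x : E4) 0 = τ}))
    (hexact : ∀ (x : ↥U) (v w : E4),
      𝒟.metric.val (Φ x) (mfderiv 𝓘(ℝ, E4) (𝓡 4) Φ x v) (mfderiv 𝓘(ℝ, E4) (𝓡 4) Φ x w) =
        boostedKerrBilin Λ c M a x v w)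
    (horient : ∃ ρ : ℝ, ∀ x : ↥U, (x : E4) 0 = τ → ρ ≤ Kerr.radius a (poincareInv Λ c x) →
      𝒟.timeOrientation.IsFutureDirected (mfderiv 𝓘(ℝ, E4) (𝓡 4) Φ x (E4.basisVector 0))) :
    ∀ ε : ℝ, 0 < ε → ∀ τ₁ : ℝ, ∃ τ' : ℝ, τ₁ ≤ τ' ∧
      ∃ (R : Fin 1 → ℝ) (U' : Opens E4) (Φ' : U' → 𝒟.carrier),
        SlabClauses 𝒟 k 1 (fun _ ↦ M) (fun _ ↦ a) (fun _ ↦ r₀) (fun _ ↦ (Λ, c)) ε τ' R U' Φ' := by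
  intro ε hε
  obtain ⟨R, hR⟩ := slabClauses_of_exact 𝒟 k M a r₀ Λ c hsm hemb hU hJ hachr hexact horient hε
  exact (recurrence_one_iff 𝒟 (fun _ ↦ (Λ, c)) ε).2 ⟨τ, R, U, Φ, hR⟩

/-! ### The filed crux on the exact-slab sector -/

/-- **The crux AS FILED contains the exact-slab endgame for every Lorentz orientation.** If
`KillingSpinorEndgame` holds then every admissible MGHD with complete `𝓘⁺` which carries ONE exact
boosted Kerr–Schild slab chart — sub-extremal `(M, a)`, depth `r₀ ∈ (r₋, r₊)`, ANY `Λ ∈ O(1,3)` and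
`c ∈ E4`; a smooth open embedding `Φ` of a neighbourhood `U` of `{x⁰ = τ, r > r₀}` with achronal leaf,
`range Φ ⊆ J⁺(ιX)`, `Φ^* g = boostedKerrBilin Λ c M a` on `U`, `Φ_*∂₀` future-directed on the leaf beyond
some radius — admits an honest exterior decomposition: sub-extremal holes, `O = exteriorOf`,
`HasExhaustiveCharts`, `IsFutureOriented` (the interior-lemma hypothesis (ii) being idle,
`killingSpinorEndgame_iff_honest`). No accuracy, no lateness, no smallness enters the premise.
[cite: KerrSchild1965, §3] -/
theorem honestExterior_of_exactSlab (hE : KillingSpinorEndgame) :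
    ∀ (X : Type) [TopologicalSpace X] [ChartedSpace E3 X] [IsManifold (𝓡 3) ∞ X]
      [T2Space X] [SecondCountableTopology X] [ConnectedSpace X] (D : InitialDataSet (𝓡 3) X),
      D ∈ admissibleVacuumData X → ∀ 𝒟 : VacuumCauchyDevelopment D, 𝒟.IsMaximal →
      Summit.FinalStateConjecture.HasCompleteNullInfinity 𝒟.toCauchyDevelopment →
      ∀ (M a r₀ : ℝ) (Λ : lorentzGroup) (c : E4), Kerr.IsSubextremal M a →
      r₀ ∈ Ioo (Kerr.rMinus M a) (Kerr.rPlus M a) →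
      ∀ (U : Opens E4) (Φ : U → 𝒟.carrier) (τ : ℝ),
      ContMDiff 𝓘(ℝ, E4) (𝓡 4) ∞ Φ → Topology.IsOpenEmbedding Φ →
      {x : E4 | x 0 = τ ∧ r₀ < Kerr.radius a (poincareInv Λ c x)} ⊆ (U : Set E4) →
      range Φ ⊆ 𝒟.metric.causalFuture 𝒟.timeOrientation (range 𝒟.embed) →
      𝒟.metric.IsAchronal 𝒟.timeOrientation (Φ '' {x : ↥U | (x : E4) 0 = τ}) →
      (∀ (x : ↥U) (v w : E4),
        𝒟.metric.val (Φ x) (mfderiv 𝓘(ℝ, E4) (𝓡 4) Φ x v) (mfderiv 𝓘(ℝ, E4) (𝓡 4) Φ x w) =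
          boostedKerrBilin Λ c M a x v w) →
      (∃ ρ : ℝ, ∀ x : ↥U, (x : E4) 0 = τ → ρ ≤ Kerr.radius a (poincareInv Λ c x) →
        𝒟.timeOrientation.IsFutureDirected (mfderiv 𝓘(ℝ, E4) (𝓡 4) Φ x (E4.basisVector 0))) →
      ∃ (O : Set 𝒟.carrier) (d : FinalStateDecomposition 𝒟.toSpacetime O 2),
        (∀ i, Kerr.IsSubextremal (d.mass i) (d.spin i)) ∧
        O = Summit.FinalStateConjecture.exteriorOf 𝒟.toCauchyDevelopment d.charted ∧
        Summit.FinalStateConjecture.HasExhaustiveCharts d ∧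
        Summit.FinalStateConjecture.IsFutureOriented d := by
  obtain ⟨k, hk⟩ := killingSpinorEndgame_iff_honest.1 hE
  intro X _ _ _ _ _ _ D hD 𝒟 hmax hscri M a r₀ Λ c hsub hr₀ U Φ τ hsm hemb hU hJ hachr hexact horient
  exact hk X D hD 𝒟 hmax hscri ⟨1, fun _ ↦ M, fun _ ↦ a, fun _ ↦ r₀, fun _ ↦ (Λ, c),
    fun _ ↦ ⟨hsub, hr₀⟩, recurs_of_exact 𝒟 k M a r₀ Λ c hsm hemb hU hJ hachr hexact horient⟩

/-! ### The time-reversed Schwarzschild Kerr–Schild form is the outgoing (white-hole) form -/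

/-- Time reversal fixes the first spatial coordinate. [folklore] -/
theorem timeReversalCLM_apply_one (z : E4) : timeReversalCLM z 1 = z 1 :=
  timeReversalCLM_apply_succ z 0

/-- Time reversal fixes the second spatial coordinate. [folklore] -/
theorem timeReversalCLM_apply_two (z : E4) : timeReversalCLM z 2 = z 2 :=
  timeReversalCLM_apply_succ z 1

/-- Time reversal fixes the third spatial coordinate. [folklore] -/
theorem timeReversalCLM_apply_three (z : E4) : timeReversalCLM z 3 = z 3 :=
  timeReversalCLM_apply_succ z 2

/-- Time reversal preserves the spatial radius `‖z̲‖`. [folklore] -/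
theorem spatialNorm_timeReversalCLM (z : E4) :
    E4.spatialNorm (timeReversalCLM z) = E4.spatialNorm z := by
  have h1 := E4.spatialNorm_sq (timeReversalCLM z)
  have h2 := E4.spatialNorm_sq z
  rw [timeReversalCLM_apply_one, timeReversalCLM_apply_two, timeReversalCLM_apply_three] at h1
  nlinarith [E4.spatialNorm_nonneg (timeReversalCLM z), E4.spatialNorm_nonneg z]

/-- The rest-frame Schwarzschild Kerr–Schild radius of the time-reversed motion `(T, c)` is the lab
spatial distance from the centre: `r_0(T(x − c)) = ‖x̲ − c̲‖`. [folklore] -/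
theorem radius_poincareInv_timeReversal (c x : E4) :
    Kerr.radius 0 (poincareInv timeReversalLorentz c x) = E4.spatialNorm (x - c) := by
  change Kerr.radius 0 (timeReversalCLM (x - c)) = E4.spatialNorm (x - c)
  rw [Kerr.radius_zero_left, spatialNorm_timeReversalCLM]

/-- **The time-reversed Schwarzschild Kerr–Schild form is the OUTGOING Eddington–Finkelstein /
Kerr–Schild form**: `g_{M,0}(Tz)(Tv, Tw) = η(v, w) + (2M/r) ℓ_out(v) ℓ_out(w)` with `r = ‖z̲‖` and
`ℓ_out = dt − dr`, `ℓ_out(v) = v⁰ − (z̲·v̲)/r` (the ingoing covector is `dt + dr`; time reversal flips the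
relative sign). This is the Schwarzschild metric regular across the PAST (white-hole) horizon `r = 2M`.
Kerr–Schild 1965, §2 (the discrete Lorentz element `T` acting on the ansatz `η + 2H ℓ ⊗ ℓ`);
Dafermos–Rodnianski arXiv:0811.0354, §5.1 (ingoing form). [cite: KerrSchild1965, §2] -/
theorem kerr_bilin_timeReversal_eq_outgoing (M : ℝ) (z v w : E4) :
    Kerr.bilin M 0 (timeReversalCLM z) (timeReversalCLM v) (timeReversalCLM w) =
      Minkowski.bilin v w + 2 * (M / E4.spatialNorm z) *
        ((v 0 - (z 1 * v 1 + z 2 * v 2 + z 3 * v 3) / E4.spatialNorm z) *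
         (w 0 - (z 1 * w 1 + z 2 * w 2 + z 3 * w 3) / E4.spatialNorm z)) := by
  have hη : Minkowski.bilin (timeReversalCLM v) (timeReversalCLM w) = Minkowski.bilin v w := by
    simp [Minkowski.bilin_apply, Fin.sum_univ_three]
  have hr : Kerr.radius 0 (timeReversalCLM z) = E4.spatialNorm z := by
    rw [Kerr.radius_zero_left, spatialNorm_timeReversalCLM]
  have hH : Kerr.scalarH M 0 (timeReversalCLM z) = M / E4.spatialNorm z := by
    unfold Kerr.scalarH
    rw [hr]
    by_cases h0 : E4.spatialNorm z = 0
    · simp [h0]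
    · field_simp
      ring
  have hℓ : ∀ u : E4, Kerr.nullCovector 0 (timeReversalCLM z) (timeReversalCLM u) =
      -(u 0 - (z 1 * u 1 + z 2 * u 2 + z 3 * u 3) / E4.spatialNorm z) := by
    intro u
    simp only [Kerr.nullCovector, Kerr.nullCovectorFun, E4.covector_apply, Fin.sum_univ_four,
      Matrix.cons_val_zero, Matrix.cons_val_one, Matrix.cons_val, hr,
      timeReversalCLM_apply_zero, timeReversalCLM_apply_one, timeReversalCLM_apply_two,
      timeReversalCLM_apply_three]
    by_cases h0 : E4.spatialNorm z = 0
    · simp [h0]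
    · field_simp
      ring
  rw [Kerr.bilin_apply, hη, hH, hℓ v, hℓ w]
  ring

/-! ### The white-hole sector -/

/-- **The white-hole sector of the filed crux.** If `KillingSpinorEndgame` holds then every admissible
MGHD with complete `𝓘⁺` containing ONE exact OUTGOING (white-hole) Eddington–Finkelstein/Kerr–Schild
Schwarzschild slab — mass `M > 0`, centre `c`, depth `r₀ ∈ (0, 2M)`, so that the punctured hyperplane
`{x⁰ = τ, ‖x̲ − c̲‖ > r₀}` STRADDLES the past horizon `‖x̲ − c̲‖ = 2M`; a smooth open embedding `Φ` of a
neighbourhood `U` of it with achronal leaf, `range Φ ⊆ J⁺(ιX)`, `Φ_*∂₀` future-directed beyond some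
radius, and on `U`
`g(dΦ v, dΦ w) = η(v, w) + (2M/r)(v⁰ − (z̲·v̲)/r)(w⁰ − (z̲·w̲)/r)`, `z = x − c`, `r = ‖z̲‖` —
admits an honest exterior decomposition into sub-extremal Kerr BLACK holes (`O = exteriorOf`,
`HasExhaustiveCharts`, `IsFutureOriented`). Proof: the outgoing form is `boostedKerrBilin T c M 0`
(`kerr_bilin_timeReversal_eq_outgoing`, `boostedKerrBilin_timeReversal_apply`) with `T` = time reversal,
a legal motion of clause (i) (`lorentzGroup = O(1,3)`; `T` is not orthochronous,
`not_isOrthochronous_timeReversalLorentz`), `(M, 0)` is sub-extremal and `r₀ ∈ (r₋, r₊) = (0, 2M)`, so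
`honestExterior_of_exactSlab` applies. The premise is `ε`-free, lateness-free and smallness-free and
concerns an EARLY region (it is met, on paper, by the ℝP³-geon configuration of
`Cruxes/KillingSpinorEndgame/Lines/registered_dead.md` §2): on this sector the crux is the pointwise
large-data final-state assertion for white-hole-emergent data. Restatement advice (F2): require
`IsOrthochronous (mo i).1` in clause (i). [cite: KerrSchild1965, §2] -/
theorem whiteHole_settles_of_killingSpinorEndgame (hE : KillingSpinorEndgame) :
    ∀ (X : Type) [TopologicalSpace X] [ChartedSpace E3 X] [IsManifold (𝓡 3) ∞ X]
      [T2Space X] [SecondCountableTopology X] [ConnectedSpace X] (D : InitialDataSet (𝓡 3) X),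
      D ∈ admissibleVacuumData X → ∀ 𝒟 : VacuumCauchyDevelopment D, 𝒟.IsMaximal →
      Summit.FinalStateConjecture.HasCompleteNullInfinity 𝒟.toCauchyDevelopment →
      ∀ (M r₀ : ℝ) (c : E4), 0 < M → r₀ ∈ Ioo 0 (2 * M) →
      ∀ (U : Opens E4) (Φ : U → 𝒟.carrier) (τ : ℝ),
      ContMDiff 𝓘(ℝ, E4) (𝓡 4) ∞ Φ → Topology.IsOpenEmbedding Φ →
      {x : E4 | x 0 = τ ∧ r₀ < E4.spatialNorm (x - c)} ⊆ (U : Set E4) →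
      range Φ ⊆ 𝒟.metric.causalFuture 𝒟.timeOrientation (range 𝒟.embed) →
      𝒟.metric.IsAchronal 𝒟.timeOrientation (Φ '' {x : ↥U | (x : E4) 0 = τ}) →
      (∀ (x : ↥U) (v w : E4),
        𝒟.metric.val (Φ x) (mfderiv 𝓘(ℝ, E4) (𝓡 4) Φ x v) (mfderiv 𝓘(ℝ, E4) (𝓡 4) Φ x w) =
          Minkowski.bilin v w + 2 * (M / E4.spatialNorm ((x : E4) - c)) *
            ((v 0 - (((x : E4) - c) 1 * v 1 + ((x : E4) - c) 2 * v 2 + ((x : E4) - c) 3 * v 3) /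
                E4.spatialNorm ((x : E4) - c)) *
             (w 0 - (((x : E4) - c) 1 * w 1 + ((x : E4) - c) 2 * w 2 + ((x : E4) - c) 3 * w 3) /
                E4.spatialNorm ((x : E4) - c)))) →
      (∃ ρ : ℝ, ∀ x : ↥U, (x : E4) 0 = τ → ρ ≤ E4.spatialNorm ((x : E4) - c) →
        𝒟.timeOrientation.IsFutureDirected (mfderiv 𝓘(ℝ, E4) (𝓡 4) Φ x (E4.basisVector 0))) →
      ∃ (O : Set 𝒟.carrier) (d : FinalStateDecomposition 𝒟.toSpacetime O 2),
        (∀ i, Kerr.IsSubextremal (d.mass i) (d.spin i)) ∧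
        O = Summit.FinalStateConjecture.exteriorOf 𝒟.toCauchyDevelopment d.charted ∧
        Summit.FinalStateConjecture.HasExhaustiveCharts d ∧
        Summit.FinalStateConjecture.IsFutureOriented d := by
  intro X _ _ _ _ _ _ D hD 𝒟 hmax hscri M r₀ c hM hr₀ U Φ τ hsm hemb hU hJ hachr hexact horient
  have hsub : Kerr.IsSubextremal M 0 := by
    change |(0 : ℝ)| < M
    rwa [abs_zero]
  have hrm : Kerr.rMinus M 0 = 0 := by simp [Kerr.rMinus, Real.sqrt_sq hM.le]
  have hr₀' : r₀ ∈ Ioo (Kerr.rMinus M 0) (Kerr.rPlus M 0) := by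
    rwa [hrm, Kerr.rPlus_zero_right hM.le]
  have hU' : {x : E4 | x 0 = τ ∧ r₀ < Kerr.radius 0 (poincareInv timeReversalLorentz c x)} ⊆
      (U : Set E4) := by
    rintro x ⟨hx0, hxr⟩
    rw [radius_poincareInv_timeReversal] at hxr
    exact hU ⟨hx0, hxr⟩
  have horient' : ∃ ρ : ℝ, ∀ x : ↥U, (x : E4) 0 = τ →
      ρ ≤ Kerr.radius 0 (poincareInv timeReversalLorentz c x) →
      𝒟.timeOrientation.IsFutureDirected (mfderiv 𝓘(ℝ, E4) (𝓡 4) Φ x (E4.basisVector 0)) := by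
    obtain ⟨ρ, hρ⟩ := horient
    refine ⟨ρ, fun x hx0 hxr ↦ hρ x hx0 ?_⟩
    rwa [radius_poincareInv_timeReversal] at hxr
  refine honestExterior_of_exactSlab hE X D hD 𝒟 hmax hscri M 0 r₀ timeReversalLorentz c hsub hr₀' U Φ τ
    hsm hemb hU' hJ hachr (fun x v w ↦ ?_) horient'
  rw [hexact, boostedKerrBilin_timeReversal_apply, kerr_bilin_timeReversal_eq_outgoing]

end Summit.FinalStateConjecture.FinalStateConjecture.Theorems.KerrnessPropagates

end
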